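import Summits.QuantumFields.QCD.Theses.EulerDescent
import Summits.QuantumFields.QCD.Theorems.EulerDescentRayDescentStubHarnackConeChord
import HarnessLib.Audit

/-!
# Line `Sketch` (half-plane Harnack) for the crux `RayDescent` (item stmt-QuantumFields-16900)

Route `EulerDescent` (sub-problem QCD), crux decl
`Summit.QuantumFields.QCD.Theses.EulerDescent.RayDescent` (rev 1; rank 2).

Lead prover's skeleton (seat `prover-line-stmt-QuantumFields-16900-0`, 2026-08-17), built on the
crux-ideate `Sketch.lean` of ideator k2 (ideas `half-plane-harnack` and
`bernstein-sea-stripped-concavity`) and on the registrar's `Lines/birth.lean`.  It keeps birth's cut at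
the PIN verbatim (§0–§1: currency, `CornerDescentStmt`, `RepinInvarianceStmt`, and birth's
kernel-checked sandwich, copied into `RayDescent_of`) and realises the exact-corner Euler law
`CornerDescentStmt` by the HALF-PLANE HARNACK mechanism of the card `half-plane-harnack`:

* Euler's constant `1` in `Δ(m) ≥ Δ(l·m)/l` is the SHARP Harnack constant of the right half-plane
  `H = {Re t > 0}` along its normal ray: a non-negative harmonic `v` on `H` satisfies
  `v(x₁) ≥ (x₁/x₂)·v(x₂)` for `0 < x₁ ≤ x₂` (Herglotz representation; equivalently disc Harnack
  `u(w) ≥ u(0)(1−|w|)/(1+|w|)` transported by the Cayley map `t ↦ (t − x₂)/(t + x₂)`, under which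
  `(1−|w|)/(1+|w|) = x₁/x₂` exactly).  The chord inequality is closed under infima, sums and limits
  (the "Harnack cone"), so a `min` over superselection sectors costs nothing.

Stubs (every signature is written in TREE VOCABULARY ONLY — no workfile-local definition occurs in
a stub type — so that each can be landed verbatim under `Theorems/` with `--supports`; the ONLY
`sorry`s of this file are the two open stubs (M), (B)):

* `stub_harnackConeChord` — LANDED 2026-08-17 (p166243, imported): pure mathematics (Conway,
  *Functions of One Complex Variable I*, Ch. X §2; Cayley pull-back to the disc, tree
  `Complex.im_apply_ge_harnack`, Mathlib `InnerProductSpace.HarmonicOnNhd.exists_analyticOnNhd_ball_re_eq`):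
  the sharp half-plane chord inequality for non-negative harmonic functions on `{Re z > 0}`.
* `stub_harnackConeMembership` (the physics; open-problem; C⁺ of the card, its (H2)
  "Harnack-cone membership"): for a regularisation pinned EXACTLY at the intrinsic corner, with mass
  and asymptotic scaling, and a positive base tuple `m` in Lüscher's range, the volume-uniform lattice
  gap along the ray `t ↦ t·m`, `t ≥ 1`, is `liminf_k` of the trace of an INFIMUM of non-negative
  harmonic functions on the right half-plane of the complex ray parameter (vacuum dominance /
  Lee–Yang-type location of the continued singularities relative to the corner, at each coupling
  `β_k`): there are families `G k i`, each harmonic and `≥ 0` on `{Re t > 0}`, such that every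
  certified uniform rate at `t·m` is eventually `≤ G k i t` for all `i`, and every rate lying
  eventually and uniformly below all `G k i t` is certified at `t·m`.  STRICTLY STRONGER than
  `CornerDescentStmt` (the Harnack-cone hull of a function with `v(x)/x` antitone can exceed it), hence
  an honest C⁺, not a restatement; vacuous at `N_f = 0` with the crux (the corner hypothesis is
  unsatisfiable there, `Theorems/RayDescent/Negative/TrivialSlices.lean`).
* `stub_repinInvariance` (birth's stub (B), statement verbatim but with `IsCorner`/`repin`
  unfolded into tree vocabulary; size L / physics: UV robustness of the pin).

Composition (kernel-checked, no `sorry` outside `stub_*`):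
`cornerDescent_of_harnack : stub_harnackConeChord → stub_harnackConeMembership → CornerDescentStmt`
(gap `Δ` at `l·m` ⇒ eventually `Δ ≤ G k i l` ⇒ `G k i 1 ≥ G k i l / l ≥ Δ/l = Δ' + ε` for every `i` ⇒ gap `Δ'` at `m`),
then birth's sandwich: `RayDescent_of : stub_harnackConeMembership → stub_repinInvariance → RayDescent`
(the landed chord is discharged inside), and `rayDescent_of_stubs : RayDescent`.

Negative knowledge honoured.  Cycle 1 (2026-08-17): CruxAttack-g1 / `Negative/TrivialSlices.lean`
(`l = 1` slice free — the chord at `x₁ = x₂` is equality; `N_f = 0` vacuous — every stub with physics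
content carries the corner hypothesis verbatim; rescaling covariance — the chord is invariant under
`t ↦ ct`, `Δ ↦ cΔ`); corner + pin load-bearing jointly (`Negative/CornerPinLoadBearing.lean`,
p167133: the half-plane boundary is the vertical line THROUGH the corner, so only the exact-corner
law is claimed and birth's re-pin stub is kept); STRATEGY-CENSUS T1 (the typed crux needs a
COMPARISON principle — here positivity of harmonic functions on a domain, indifferent to the signed
Wilson determinant).  Cycle 2 (lead c1, 2026-08-17, `Cruxes/RayDescent/Disproof.lean` cycle 1 read):
no kill; (M) carries a hidden upward chord law (`Negative/ConeMembershipUpwardLaw.lean`, p167257 —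
harmless, unused by the composition); (B) with a merely bounded pin is false
(`Negative/PinTolerance.lean`, p167812 — the registered signature keeps `e_k → 0`); the content of
(M) beyond the crux is now bracketed by LANDED theorems:
`[gap shape along the ray concave ∧ non-decreasing ∧ subhomogeneous, eventually in k] ⟹ (M)`
(`Theorems/EulerDescentRayDescentConeMembershipOfConcaveShape.lean`,
`harnackConeConclusion_of_concaveShapes`, via `Literature.Analysis.Convex.exists_affine_majorant_le_add`,
p172268) and `(M) ⟹ both chord laws ⟹̸ (M)`
(`Literature.Analysis.Complex.not_harnackHull_max_one_half`, p172754: `max 1 (x/2)` obeys both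
chord laws but every non-negative harmonic majorant family has `inf G(2) ≥ 9/8`, by the three-point
Harnack inequality `v(2) ≥ v(1)/4 + 7v(9)/36`).  NO RESHAPE: a pairwise-in-`l` family would be a
costume of `CornerDescentStmt` (the two-point Harnack hull is exactly the chord law), a smaller
domain than the half-plane loses the constant `1`; (M) stays the honest whole-ray C⁺.  (B): workers
W2, W3 `stub-blocked: none` — missing unit `subResolutionGapContinuity` (uniform-in-`k` continuity
of the volume-uniform gap in the renormalised mass above the intrinsic corner; no tree or corpus
source); free slices landed (`Theorems/EulerDescentRayDescentStubRepinInvariance.lean`, p172321: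
`N_f = 0`, eventually-equal pins).
-/

noncomputable section

namespace Summit.QuantumFields.QCD.Cruxes.RayDescent.Sketch

open scoped Topology
open Filter
open Literature.MathematicalPhysics.QuantumFieldTheory
open Summit.QuantumFields.QCD.Theses.EulerDescent

/-! ## §0 Currency — verbatim from `Lines/birth.lean` (sub-formulas of the crux) -/

/-- **Lattice QCD at coupling `β` and DEGENERATE bare Wilson mass `μ` is massive** (verbatim the
clause the crux negates inside its corner set). -/
def MassiveAt (Nf : ℕ) (β μ : ℝ) : Prop :=
  ∀ (R R' : ℕ) (A : QCDLatticeObservable Nf R) (B : QCDLatticeObservable Nf R'),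
    ∃ (C δ : ℝ) (S₀ : ℕ), 0 < δ ∧ ∀ S : ℕ, S₀ ≤ S → ∀ n : ℕ, n ≤ S →
      ‖qcdLatticeConnectedCorr β (2 * S + 1) (fun _ : Fin Nf => μ) A B n‖ ≤ C * Real.exp (-(δ * n))

/-- **`c` is (eventually) the INTRINSIC Wilson corner of `reg`'s coupling sequence** (verbatim the
crux's corner hypothesis with the candidate `c` in place of `mc`). -/
def IsCorner {Nf : ℕ} (reg : QCDRegularisation Nf) (c : ℕ → ℝ) : Prop :=
  ∀ᶠ k in atTop, IsLUB {μ : ℝ | ¬ MassiveAt Nf (reg.β k) μ} (c k)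

/-- **Re-pinning**: the regularisation with the same `a, β, L, Z_m` and critical-mass sequence `mc`. -/
def repin {Nf : ℕ} (reg : QCDRegularisation Nf) (mc : ℕ → ℝ) : QCDRegularisation Nf :=
  { reg with mcrit := mc }

section repin_lemmas

variable {Nf : ℕ} (reg : QCDRegularisation Nf) (mc : ℕ → ℝ)

/-- Re-pinning back to the original critical mass is the identity. [folklore] -/
@[simp] theorem repin_repin : repin (repin reg mc) reg.mcrit = reg := by
  cases reg
  rfl

/-- Mass scaling reads only `a, Z_m`. [folklore] -/
theorem hasMassScaling_repin (h : reg.HasMassScaling) : (repin reg mc).HasMassScaling := h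

/-- Asymptotic scaling reads only `a, β`. [folklore] -/
theorem hasAsymptoticScaling_repin (h : (reg.scheme 0 0 0).HasAsymptoticScaling) :
    ((repin reg mc).scheme 0 0 0).HasAsymptoticScaling := h

end repin_lemmas

/-! ## §1 Birth's two statements (verbatim; birth's sandwich proof is copied into `RayDescent_of`, §5) -/

/-- **Euler descent at the EXACT corner** (birth's stub (A) statement, verbatim). In THIS file it
is DERIVED from `stub_harnackConeChord` and `stub_harnackConeMembership`
(`cornerDescent_of_harnack`). -/
def CornerDescentStmt : Prop :=
  ∀ (Nf : ℕ) (reg : QCDRegularisation Nf), IsCorner reg reg.mcrit → reg.HasMassScaling →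
    (reg.scheme 0 0 0).HasAsymptoticScaling →
    ∀ m : Fin Nf → ℝ, (∀ f, 0 < m f) →
      (∀ᶠ k in atTop, ∀ f, (-1 : ℝ) < reg.mcrit k + reg.a k * m f / reg.Zm k) →
      ∀ l : ℝ, 1 ≤ l → ∀ Δ : ℝ, 0 < Δ →
        (reg.scheme (fun f => l * m f) 0 0).HasLatticeMassGap Δ →
        ∀ Δ' : ℝ, 0 < Δ' → Δ' < Δ / l → (reg.scheme m 0 0).HasLatticeMassGap Δ'

/-- **Sub-resolution re-pinning invariance of the uniform lattice gap** (birth's stub (B)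
statement, verbatim). -/
def RepinInvarianceStmt : Prop :=
  ∀ (Nf : ℕ) (reg : QCDRegularisation Nf) (mc : ℕ → ℝ),
    (IsCorner reg reg.mcrit ∨ IsCorner reg mc) →
    Tendsto (fun k => (reg.mcrit k - mc k) * reg.Zm k / reg.a k) atTop (𝓝 0) →
    reg.HasMassScaling → (reg.scheme 0 0 0).HasAsymptoticScaling →
    ∀ m : Fin Nf → ℝ, (∀ f, 0 < m f) →
      (∀ᶠ k in atTop, ∀ f, (-1 : ℝ) < reg.mcrit k + reg.a k * m f / reg.Zm k ∧
        (-1 : ℝ) < mc k + reg.a k * m f / reg.Zm k) →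
      ∀ Δ : ℝ, 0 < Δ → (reg.scheme m 0 0).HasLatticeMassGap Δ →
        ∀ Δ' : ℝ, 0 < Δ' → Δ' < Δ → ((repin reg mc).scheme m 0 0).HasLatticeMassGap Δ'


/-! ## §2 The two statements of this line: the sharp half-plane chord, and Harnack-cone membership -/

/-- **The sharp Harnack chord of the right half-plane** (pure mathematics; the first lemma of the
card `half-plane-harnack`, verbatim): a non-negative harmonic function `v` on `{Re z > 0}` satisfies
`(x₁/x₂)·v(x₂) ≤ v(x₁)` for `0 < x₁ ≤ x₂` — `v(x)/x` is non-increasing along the normal ray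
(Herglotz: `v(x) = cx + π⁻¹∫ x dν(s)/(x² + s²)`).  Conway, *Functions of One Complex Variable I*,
Ch. X §2 (Harnack), transported from the disc by the Cayley map. -/
def HarnackConeChord : Prop :=
  ∀ v : ℂ → ℝ, InnerProductSpace.HarmonicOnNhd v {z : ℂ | 0 < z.re} →
    (∀ z : ℂ, 0 < z.re → 0 ≤ v z) →
    ∀ x₁ x₂ : ℝ, 0 < x₁ → x₁ ≤ x₂ → x₁ / x₂ * v x₂ ≤ v x₁

/-- **Harnack-cone membership of the uniform lattice gap along a mass ray** (the physics C⁺ of the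
card `half-plane-harnack`, (H2); open-problem).  For every `N_f` and every regularisation `reg`
whose critical mass IS eventually the intrinsic Wilson corner, with leading-log mass scaling and
two-loop asymptotic scaling, and every positive base tuple `m` whose bare trajectory is eventually in
Lüscher's range: there is, at every step `k`, a family `G k i : ℂ → ℝ` (think: the level gaps
`Re(E_j(t) − E_0(t))/a_k` of the `S → ∞` transfer matrix at coupling `β_k`, in physical units, over
all superselection sectors and levels `i`) of functions HARMONIC and NON-NEGATIVE on the open right
half-plane `{Re t > 0}` of the complex ray parameter such that, for every real `t ≥ 1`, (upper)
every uniform lattice rate `Δ > 0` certified at the tuple `t·m` satisfies `Δ ≤ G k i t` for all `i`,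
eventually in `k`, and (lower) every rate `Δ > 0` with `Δ + ε ≤ G k i t` for all `i`, eventually in
`k`, for some `ε > 0`, IS certified at `t·m` — i.e. the volume-uniform gap along the ray is
`liminf_k inf_i G k i` (no continuum limit of the level functions is presupposed).
Why plausibly true: each level gap `Re(E_j(t) − E_0(t))` of the continued transfer matrix in a
superselection sector is harmonic where the continued vacuum stays dominant, and the physical gap is
their infimum over sectors and channels; vacuum dominance on the whole half-plane anchored at the
corner (a Lee–Yang-type LOCATION statement: continued singularities stay in `Re t ≤ 0`) is exactly
what makes Euler's constant `1` (sector of half-angle `α` ⇒ constant `π/(2α)`); at `β = 0` the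
Kawamoto–Smit pion has all singularities on the negative axis and `Re m_π > 0` on the slit plane
(card's toy check), explaining the measured share `≤ 0.4998`.  Why it might fail: a complex-mass
phase boundary entering `Re t > 0` at weak coupling (then the sharp constant `1` fails by this
mechanism and a share `> 1` is predicted nearby); for odd `N_f` the real-axis functional is already
signed (barrier `WilsonDeterminantSign`), so zero-freeness of the AVERAGED twisted partition function
has no configuration-wise positivity to lean on. -/
def HarnackConeMembershipStmt : Prop :=
  ∀ (Nf : ℕ) (reg : QCDRegularisation Nf), IsCorner reg reg.mcrit → reg.HasMassScaling →
    (reg.scheme 0 0 0).HasAsymptoticScaling →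
    ∀ m : Fin Nf → ℝ, (∀ f, 0 < m f) →
      (∀ᶠ k in atTop, ∀ f, (-1 : ℝ) < reg.mcrit k + reg.a k * m f / reg.Zm k) →
      ∃ (ι : Type) (G : ℕ → ι → ℂ → ℝ),
        (∀ k i, InnerProductSpace.HarmonicOnNhd (G k i) {z : ℂ | 0 < z.re}) ∧
        (∀ k i (z : ℂ), 0 < z.re → 0 ≤ G k i z) ∧
        (∀ t : ℝ, 1 ≤ t → ∀ Δ : ℝ, 0 < Δ →
          (reg.scheme (fun f => t * m f) 0 0).HasLatticeMassGap Δ → ∀ᶠ k in atTop, ∀ i, Δ ≤ G k i t) ∧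
        (∀ t : ℝ, 1 ≤ t → ∀ Δ : ℝ, 0 < Δ → (∃ ε : ℝ, 0 < ε ∧ ∀ᶠ k in atTop, ∀ i, Δ + ε ≤ G k i t) →
          (reg.scheme (fun f => t * m f) 0 0).HasLatticeMassGap Δ)

/-! ## §3 The registered stubs (the ONLY `sorry`s of this file), signatures in tree vocabulary -/

/-! (H) `stub_harnackConeChord` — the sharp half-plane Harnack chord — is LANDED (p166243,
`Theorems/EulerDescentRayDescentStubHarnackConeChord.lean`, axioms propext/Classical.choice/Quot.sound)
and imported above under its registered name
`Summit.QuantumFields.QCD.Cruxes.RayDescent.Sketch.stub_harnackConeChord`; its registered signature was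
`∀ v : ℂ → ℝ, InnerProductSpace.HarmonicOnNhd v {z : ℂ | 0 < z.re} → (∀ z : ℂ, 0 < z.re → 0 ≤ v z) →
 ∀ x₁ x₂ : ℝ, 0 < x₁ → x₁ ≤ x₂ → x₁ / x₂ * v x₂ ≤ v x₁`. -/

/-- The landed stub (H) has exactly the statement `HarnackConeChord`. -/
theorem harnackConeChord_holds : HarnackConeChord := stub_harnackConeChord

/-- (M) Harnack-cone membership of the uniform lattice gap along mass rays from the exact corner —
open-problem (the physics; C⁺ of the card `half-plane-harnack`). -/
theorem stub_harnackConeMembership :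
    ∀ (Nf : ℕ) (reg : QCDRegularisation Nf),
      (∀ᶠ k in atTop, IsLUB {μ : ℝ | ¬ (∀ (R R' : ℕ) (A : QCDLatticeObservable Nf R)
          (B : QCDLatticeObservable Nf R'), ∃ (C δ : ℝ) (S₀ : ℕ), 0 < δ ∧ ∀ S : ℕ, S₀ ≤ S →
            ∀ n : ℕ, n ≤ S → ‖qcdLatticeConnectedCorr (reg.β k) (2 * S + 1) (fun _ : Fin Nf => μ)
              A B n‖ ≤ C * Real.exp (-(δ * n)))} (reg.mcrit k)) →
      reg.HasMassScaling → (reg.scheme 0 0 0).HasAsymptoticScaling →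
      ∀ m : Fin Nf → ℝ, (∀ f, 0 < m f) →
        (∀ᶠ k in atTop, ∀ f, (-1 : ℝ) < reg.mcrit k + reg.a k * m f / reg.Zm k) →
        ∃ (ι : Type) (G : ℕ → ι → ℂ → ℝ),
          (∀ k i, InnerProductSpace.HarmonicOnNhd (G k i) {z : ℂ | 0 < z.re}) ∧
          (∀ k i (z : ℂ), 0 < z.re → 0 ≤ G k i z) ∧
          (∀ t : ℝ, 1 ≤ t → ∀ Δ : ℝ, 0 < Δ →
            (reg.scheme (fun f => t * m f) 0 0).HasLatticeMassGap Δ →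
              ∀ᶠ k in atTop, ∀ i, Δ ≤ G k i t) ∧
          (∀ t : ℝ, 1 ≤ t → ∀ Δ : ℝ, 0 < Δ →
            (∃ ε : ℝ, 0 < ε ∧ ∀ᶠ k in atTop, ∀ i, Δ + ε ≤ G k i t) →
              (reg.scheme (fun f => t * m f) 0 0).HasLatticeMassGap Δ) := by
  sorry

/-- (B) birth's sub-resolution re-pinning invariance of the uniform lattice gap — size L (shared in
substance with `Lines/birth.lean` and `Lines/continuity_induction.lean`; `IsCorner` and `repin` are
unfolded so that the signature is tree vocabulary). -/
theorem stub_repinInvariance :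
    ∀ (Nf : ℕ) (reg : QCDRegularisation Nf) (mc : ℕ → ℝ),
      ((∀ᶠ k in atTop, IsLUB {μ : ℝ | ¬ (∀ (R R' : ℕ) (A : QCDLatticeObservable Nf R)
          (B : QCDLatticeObservable Nf R'), ∃ (C δ : ℝ) (S₀ : ℕ), 0 < δ ∧ ∀ S : ℕ, S₀ ≤ S →
            ∀ n : ℕ, n ≤ S → ‖qcdLatticeConnectedCorr (reg.β k) (2 * S + 1) (fun _ : Fin Nf => μ)
              A B n‖ ≤ C * Real.exp (-(δ * n)))} (reg.mcrit k)) ∨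
        (∀ᶠ k in atTop, IsLUB {μ : ℝ | ¬ (∀ (R R' : ℕ) (A : QCDLatticeObservable Nf R)
          (B : QCDLatticeObservable Nf R'), ∃ (C δ : ℝ) (S₀ : ℕ), 0 < δ ∧ ∀ S : ℕ, S₀ ≤ S →
            ∀ n : ℕ, n ≤ S → ‖qcdLatticeConnectedCorr (reg.β k) (2 * S + 1) (fun _ : Fin Nf => μ)
              A B n‖ ≤ C * Real.exp (-(δ * n)))} (mc k))) →
      Tendsto (fun k => (reg.mcrit k - mc k) * reg.Zm k / reg.a k) atTop (𝓝 0) →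
      reg.HasMassScaling → (reg.scheme 0 0 0).HasAsymptoticScaling →
      ∀ m : Fin Nf → ℝ, (∀ f, 0 < m f) →
        (∀ᶠ k in atTop, ∀ f, (-1 : ℝ) < reg.mcrit k + reg.a k * m f / reg.Zm k ∧
          (-1 : ℝ) < mc k + reg.a k * m f / reg.Zm k) →
        ∀ Δ : ℝ, 0 < Δ → (reg.scheme m 0 0).HasLatticeMassGap Δ →
          ∀ Δ' : ℝ, 0 < Δ' → Δ' < Δ →
            (({ reg with mcrit := mc } : QCDRegularisation Nf).scheme m 0 0).HasLatticeMassGap Δ' := by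
  sorry

/-! ### Name-keyed aliases of the stub statements (device of `Lines/birth.lean`: the native
skeleton audit admits a hypothesis of the composing theorem whose head constant is NAMED like a
declared stub). Each alias is `rfl`-equal to the corresponding statement of §1–§2. -/
namespace __Registered

/-- Alias of `HarnackConeMembershipStmt` keyed by the registered stub name. -/
abbrev stub_harnackConeMembership : Prop := HarnackConeMembershipStmt
/-- Alias of `RepinInvarianceStmt` keyed by the registered stub name. -/
abbrev stub_repinInvariance : Prop := RepinInvarianceStmt

end __Registered

/-! ## §4 Proved glue (no `sorry` below this line) -/

/-- **Exact-corner Euler descent from the Harnack chord and Harnack-cone membership**: gap `Δ` at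
`l·m` ⇒ eventually in `k`, `Δ ≤ G k i l` for all `i` (upper clause) ⇒ `G k i 1 ≥ G k i l / l ≥ Δ / l
= Δ' + ε` (chord, `ε := Δ/l − Δ' > 0`) ⇒ gap `Δ'` at `m` (lower clause at `t = 1`). -/
theorem cornerDescent_of_harnack (hH : HarnackConeChord) (hM : HarnackConeMembershipStmt) :
    CornerDescentStmt := by
  intro Nf reg hc hms haf m hm hrange l hl Δ hΔ hgap Δ' hΔ' hlt
  have hl0 : 0 < l := lt_of_lt_of_le one_pos hl
  obtain ⟨ι, G, hharm, hnonneg, hupper, hlower⟩ := hM Nf reg hc hms haf m hm hrange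
  -- upper clause at `t = l`, eventually in `k`
  have h1 : ∀ᶠ k in atTop, ∀ i, Δ ≤ G k i (l : ℂ) := hupper l hl Δ hΔ hgap
  -- uniform slack at `t = 1`
  obtain ⟨ε, hε⟩ : ∃ ε : ℝ, ε = Δ / l - Δ' := ⟨_, rfl⟩
  have hεpos : 0 < ε := by rw [hε]; linarith
  have h3 : ∀ᶠ k in atTop, ∀ i, Δ' + ε ≤ G k i ((1 : ℝ) : ℂ) := by
    filter_upwards [h1] with k hk i
    -- the sharp chord between `x₁ = 1` and `x₂ = l` for the non-negative harmonic `G k i`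
    have h2 : 1 / l * G k i (l : ℂ) ≤ G k i ((1 : ℝ) : ℂ) :=
      hH (G k i) (hharm k i) (hnonneg k i) 1 l one_pos hl
    have ha : Δ / l ≤ 1 / l * G k i (l : ℂ) := by
      rw [div_eq_mul_one_div, mul_comm]
      exact mul_le_mul_of_nonneg_left (hk i) (by positivity)
    calc Δ' + ε = Δ / l := by rw [hε]; ring
      _ ≤ 1 / l * G k i (l : ℂ) := ha
      _ ≤ G k i ((1 : ℝ) : ℂ) := h2
  -- lower clause at `t = 1`
  have h4 := hlower 1 le_rfl Δ' hΔ' ⟨ε, hεpos, h3⟩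
  have hone : (fun f => (1 : ℝ) * m f) = m := funext fun f => one_mul (m f)
  rwa [hone] at h4

/-! ## §5 Composition (kernel-checked): the crux BY NAME from the three registered stubs -/

/-- **The crux from the three stubs** (concludes `RayDescent` BY NAME).  The Harnack chord and
Harnack-cone membership give exact-corner descent (`cornerDescent_of_harnack`); then BIRTH'S SANDWICH
(`Birth.RayDescent_of`, proof copied verbatim): pin error `e_k → 0` ⇒ both trajectories in Lüscher's
range at `m` and `l·m`; rates `Δ' < Δ₂ < Δ₁/l < Δ/l`; transfer to the corner-pinned regularisation
(B), descend there (A), transfer back (B) and `repin (repin reg mc) reg.mcrit = reg`. -/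
theorem RayDescent_of :
    __Registered.stub_harnackConeMembership → __Registered.stub_repinInvariance → RayDescent := by
  intro hM hB Nf reg mc hcorner hpin hms haf hbranch m hm l hl Δ hΔ hgap Δ' hΔ' hlt
  -- stub (H) is landed: `harnackConeChord_holds` (p166243) is discharged here, not assumed
  have hA : CornerDescentStmt := cornerDescent_of_harnack harnackConeChord_holds hM
  change RepinInvarianceStmt at hB
  have hcorner' : IsCorner reg mc := hcorner
  have hl0 : 0 < l := lt_of_lt_of_le one_pos hl
  obtain ⟨e, he⟩ : ∃ e : ℕ → ℝ, ∀ k, e k = (reg.mcrit k - mc k) * reg.Zm k / reg.a k :=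
    ⟨_, fun _ => rfl⟩
  have hpe : Tendsto e atTop (𝓝 0) := by
    have h : e = fun k => (reg.mcrit k - mc k) * reg.Zm k / reg.a k := funext he
    rw [h]
    exact hpin
  have hmc : ∀ k, mc k = reg.mcrit k - reg.a k * e k / reg.Zm k := by
    intro k
    have ha : reg.a k ≠ 0 := (reg.a_pos k).ne'
    have hZ : reg.Zm k ≠ 0 := (reg.Zm_pos k).ne'
    rw [he k]
    field_simp
    ring
  have hsmall : ∀ᶠ k in atTop, ∀ f, e k < m f :=
    eventually_all.2 fun f => (tendsto_order.1 hpe).2 (m f) (hm f)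
  have hrange : ∀ X : Fin Nf → ℝ, (∀ f, m f ≤ X f) → ∀ᶠ k in atTop, ∀ f,
      (-1 : ℝ) < reg.mcrit k + reg.a k * X f / reg.Zm k ∧
        (-1 : ℝ) < mc k + reg.a k * X f / reg.Zm k := by
    intro X hX
    filter_upwards [hbranch, hsmall] with k hk hs f
    have ha : 0 < reg.a k := reg.a_pos k
    have hZ : 0 < reg.Zm k := reg.Zm_pos k
    have hq : 0 < reg.a k / reg.Zm k := div_pos ha hZ
    have hXf : 0 < X f := (hm f).trans_le (hX f)
    constructor
    · have h1 : 0 < reg.a k / reg.Zm k * X f := mul_pos hq hXf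
      have h0 : reg.a k * X f / reg.Zm k = reg.a k / reg.Zm k * X f := by ring
      linarith
    · rw [hmc k]
      have h1 : reg.mcrit k - reg.a k * e k / reg.Zm k + reg.a k * X f / reg.Zm k
          = reg.mcrit k + reg.a k / reg.Zm k * (X f - e k) := by ring
      have h2 : 0 < X f - e k := by linarith [hs f, hX f]
      have h3 : 0 < reg.a k / reg.Zm k * (X f - e k) := mul_pos hq h2
      linarith
  have hcornerR : IsCorner (repin reg mc) (repin reg mc).mcrit := hcorner'
  have hmsR : (repin reg mc).HasMassScaling := hasMassScaling_repin reg mc hms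
  have hafR : ((repin reg mc).scheme 0 0 0).HasAsymptoticScaling :=
    hasAsymptoticScaling_repin reg mc haf
  have hΔ'l : Δ' * l < Δ := (lt_div_iff₀ hl0).1 hlt
  obtain ⟨Δ₁, hΔ₁⟩ : ∃ Δ₁ : ℝ, Δ₁ = (l * Δ' + Δ) / 2 := ⟨_, rfl⟩
  have hlΔ' : 0 < l * Δ' := mul_pos hl0 hΔ'
  have hΔ₁pos : 0 < Δ₁ := by rw [hΔ₁]; linarith
  have hΔ₁lt : Δ₁ < Δ := by rw [hΔ₁]; nlinarith
  have hΔ'lt₁ : Δ' < Δ₁ / l := by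
    rw [lt_div_iff₀ hl0, hΔ₁]
    nlinarith
  obtain ⟨Δ₂, hΔ₂⟩ : ∃ Δ₂ : ℝ, Δ₂ = (Δ' + Δ₁ / l) / 2 := ⟨_, rfl⟩
  have hΔ₂pos : 0 < Δ₂ := by
    have : 0 < Δ₁ / l := div_pos hΔ₁pos hl0
    rw [hΔ₂]; linarith
  have hΔ'lt₂ : Δ' < Δ₂ := by rw [hΔ₂]; linarith
  have hΔ₂lt : Δ₂ < Δ₁ / l := by rw [hΔ₂]; linarith
  have hlm : ∀ f, 0 < l * m f := fun f => mul_pos hl0 (hm f)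
  have hmle : ∀ f, m f ≤ l * m f := fun f => le_mul_of_one_le_left (hm f).le hl
  have h1 : ((repin reg mc).scheme (fun f => l * m f) 0 0).HasLatticeMassGap Δ₁ :=
    hB Nf reg mc (Or.inr hcorner') hpin hms haf (fun f => l * m f) hlm
      (hrange (fun f => l * m f) hmle) Δ hΔ hgap Δ₁ hΔ₁pos hΔ₁lt
  have hluR : ∀ᶠ k in atTop, ∀ f,
      (-1 : ℝ) < (repin reg mc).mcrit k + (repin reg mc).a k * m f / (repin reg mc).Zm k := by
    filter_upwards [hrange m fun f => le_rfl] with k hk f using (hk f).2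
  have h2 : ((repin reg mc).scheme m 0 0).HasLatticeMassGap Δ₂ :=
    hA Nf (repin reg mc) hcornerR hmsR hafR m hm hluR l hl Δ₁ hΔ₁pos h1 Δ₂ hΔ₂pos hΔ₂lt
  have hpin' : Tendsto (fun k => ((repin reg mc).mcrit k - reg.mcrit k) * (repin reg mc).Zm k /
      (repin reg mc).a k) atTop (𝓝 0) := by
    have h := hpin.neg
    rw [neg_zero] at h
    refine h.congr' (Eventually.of_forall fun k => ?_)
    show -((reg.mcrit k - mc k) * reg.Zm k / reg.a k) = (mc k - reg.mcrit k) * reg.Zm k / reg.a k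
    ring
  have hluB : ∀ᶠ k in atTop, ∀ f,
      (-1 : ℝ) < (repin reg mc).mcrit k + (repin reg mc).a k * m f / (repin reg mc).Zm k ∧
        (-1 : ℝ) < reg.mcrit k + (repin reg mc).a k * m f / (repin reg mc).Zm k := by
    filter_upwards [hrange m fun f => le_rfl] with k hk f using ⟨(hk f).2, (hk f).1⟩
  have h3 := hB Nf (repin reg mc) reg.mcrit (Or.inl hcornerR) hpin' hmsR hafR m hm hluB
    Δ₂ hΔ₂pos h2 Δ' hΔ' hΔ'lt₂
  rwa [repin_repin] at h3

/-- The crux along this skeleton, from the registered stubs (sorries only inside `stub_*`). -/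
theorem rayDescent_of_stubs : RayDescent :=
  RayDescent_of stub_harnackConeMembership stub_repinInvariance

end Summit.QuantumFields.QCD.Cruxes.RayDescent.Sketch

end
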